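import Literature.Geometry.GaugeTheory.AdaptedFramesSpincStructure
import Literature.Geometry.GaugeTheory.SpinConnectionChartIndependence
import HarnessLib

/-!
# The canonical spinor `u₀` and the canonical connection forms of the `Spin^c` structure of an
# almost complex structure (Taubes 1994, §1; Taubes 1995, §5 Step 1) — Čech form

Topic `Literature/Geometry/GaugeTheory`; continues `AdaptedFramesSpincStructure` (the `Spin^c`
structure `𝔞.toSpincStructure` of a unitary reduction `𝔞 : AdaptedFrames g o J ι` of the frame
bundle by `J`-adapted positive orthonormal frames, transition functions
`ρ(U) = (diag(det U, 1), 0; 0, det U · Ū)` = `blockLift`, determinant cocycle `det U_ij`) and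
`SpinConnectionChartIndependence` (the transformation laws of the spin connection term
`dρ(ω̃^{(i)})` and of the transition functions, `G_ijᴴ dG_ij = dρ(hᵀdh) + ½ λ̄_ij dλ_ij`).

C. H. Taubes, *The Seiberg–Witten invariants and symplectic forms*, Math. Res. Lett. 1 (1994)
809–822, §1 (p. 810): "The bundle `K` defines a `Spin_ℂ` bundle `S = S₊ ⊕ S₋ → X` and the complex
2-plane bundle `S₊` splits as `S₊ ≈ I ⊕ K⁻¹`, where `I` is the trivial, complex line bundle. …
There is a unique connection `A₀` (up to gauge) on `K⁻¹` whose induced covariant derivative `∇_{A₀}`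
on `S₊` has `∇_{A₀} ≅ 2⁻¹(1 + i·ω)∇_{A₀}` equal to the product covariant derivative `d` on the
summand `I` in `S₊`.  In particular, for this connection `A₀`, there is a nontrivial section, `u₀`,
of `I` which is annihilated by `∇_{A₀}`.  This section `u₀` has constant length and should be
normalized to have length equal to `1`. … one has (1) `∇_{A₀} u₀ = b` where `b` is a section of
`K⁻¹ ⊗ T*_ℂ X` … (This `b` is essentially the torsion of the almost complex structure …)  The spinor
`u₀` solves the Dirac equation when `b · u₁ = 0` … expressed as the condition that `e^ν b_ν = 0`",
and (p. 811) "(3) `v₁ - i v₂ = 0` and `v₃ - i v₄ = 0`.  That is, `v` should be a section of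
`T*⁰'¹`."  C. H. Taubes, *The Seiberg–Witten and Gromov invariants*, Math. Res. Lett. 2 (1995),
§5, Step 1 (p. 233): "(5.1) `S₊ = I ⊕ K⁻¹` … the bundle `K⁻¹` has a unique connection (up to gauge
equivalence), `A₀`, which is characterized as follows: the composition of the spin covariant
derivative with orthogonal projection onto the `I` summand in (5.1) defines a covariant derivative,
`∇_{A₀}`, on said summand which annihilates a nowhere-vanishing section.  This section, `u₀`, can be
taken to have unit length."  J. W. Morgan, *The Seiberg–Witten Equations …* (1996), Cor. 3.4.5
(`S⁺_ℂ(P̃_X) = Λ⁰ ⊕ Λ^{0,2}`, the determinant line bundle is `K_X⁻¹`).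

## Rendering (0 named facts)

For `𝔞 : AdaptedFrames g o J ι` with `Spin^c` structure `𝔰 = 𝔞.toSpincStructure`, in the basis of
`S⁺ = ℂ²` used throughout the tree (`Sum.inl 0` = the line on which `ρ(U)` acts by `det U`, i.e.
`Λ²_ℂ = K⁻¹`; `Sum.inl 1` = the constants `Λ⁰ = I`):

* `AdaptedFrames.canonicalSpinor 𝔞 : SpinorField 𝔰` — **Taubes's `u₀`**: the local representative
  `(0, 1; 0, 0)` in EVERY chart.  PROVED: it is a spinor field (every transition function `ρ(U_ij)`
  fixes it — this is the statement `S⁺ ≈ I ⊕ K⁻¹` with `I` trivialised by `u₀`), positive, smooth,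
  of unit length (`hermNormSq_canonicalSpinor`), nowhere zero; the `I`-component `ψ_i(x)₁` of any
  spinor field is chart independent while the `K⁻¹`-component transforms with the determinant
  cocycle `λ_ij = det U_ij` (`toFun_inl_zero_eq`: it is a section of `det P̃ = K⁻¹`), and a positive
  spinor field decomposes as `ψ = α u₀ + β u₁` chartwise (`IsPlus.toFun_eq`; Taubes's
  `ψ = α·u₀ + β`, Morgan's `ψ = (β, α)` of §7.1).
* `covDeriv_canonicalSpinor`: for every unitary connection `A` on `det P̃`,
  `∇̃_v u₀ = ½ iA_i(v) u₀ + dρ(ω̃^{(i)}(v)) u₀` (no derivative term), with `I`-component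
  `½ iA_i(v) + dρ(ω̃^{(i)}(v))₁₁` and `K⁻¹`-component **`b_i(v) = dρ(ω̃^{(i)}(v))₀₁`**
  (`canonicalTorsion`, Taubes's `b`), the `S⁻`-components vanishing.
* `AdaptedFrames.canonicalFormFun 𝔞 i x v = -2 Im dρ(ω̃^{(i)}(v))₁₁` — **the local forms `A₀ᵢ` of
  Taubes's connection `A₀`**, and the **characterisation**
  `covDeriv_canonicalSpinor_inl_one_eq_zero_iff`: the `I`-component of `∇̃^A_v u₀` vanishes iff
  `A_i(v) = A₀ᵢ(v)` ("`∇_{A₀}` … equal to the product covariant derivative `d` on the summand `I`";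
  uniqueness of `A₀` chart by chart).  PROVED: `A₀ᵢ` is real-linear in `v` (`canonicalForm`, a
  `RealOneForm`) and satisfies **the gauge law of a unitary connection on `det P̃`**,
  `iA₀ⱼ = iA₀ᵢ + λ̄_ij dλ_ij` on `U_i ∩ U_j` (`canonicalForm_gauge`) — from
  `dρ(ω̃^{(j)}) = G_ijᴴ dρ(ω̃^{(i)}) G_ij + dρ(hᵀdh)` and `G_ijᴴ dG_ij = dρ(hᵀdh) + ½ λ̄_ij dλ_ij`
  (`SpinConnectionChartIndependence`), because `G_ij = ρ(U_ij)` has `u₀` as a CONSTANT unit column.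
* `dirac_canonicalSpinor_of_forall`: if `A_i = A₀ᵢ` at `x` then
  `∂_A u₀ = Σ_k b_i(e_k) γ_k u₁`, with components `(-b₀ + i b₁, -b₂ + i b₃)` in `S⁻`, so that
  **`∂_A u₀ (x) = 0 ↔ b₀ = i b₁ ∧ b₂ = i b₃`** (Taubes 1994, (3): `b ∈ T*⁰'¹ ⊗ K⁻¹`).

What is NOT here: smoothness of the forms `A₀ᵢ` (hence `A₀` as a `Connection`), Taubes's Lemma 1
(`dω = 0 ⟺ ∂_{A₀} u₀ = 0`), the perturbed equations — sequel files.

## References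

* C. H. Taubes, *The Seiberg–Witten invariants and symplectic forms*, Math. Res. Lett. 1 (1994)
  809–822, §1 (pp. 810–811, (1), (3)). [Taubes1994]
* C. H. Taubes, *The Seiberg–Witten and Gromov invariants*, Math. Res. Lett. 2 (1995) 221–238,
  §5 Step 1 ((5.1), p. 233). [Taubes1995]
* J. W. Morgan, *The Seiberg–Witten Equations and Applications to the Topology of Smooth
  Four-Manifolds*, Princeton Math. Notes 44 (1996), Cor. 3.4.5, §3.2 (3.2), §3.3 (3.3), §7.1.
  [MorganSWBook1996]
-/

noncomputable section

open scoped Manifold ContDiff Topology ComplexConjugate Matrix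
open Set Function Complex
open Literature.Geometry.Lorentzian (PseudoRiemannianMetric)
open Literature.Topology.FourManifolds (SmoothOrientation)

namespace Literature.Geometry.GaugeTheory

/-- Local notation: the model space `ℝ⁴`. -/
local notation "𝔼⁴" => EuclideanSpace ℝ (Fin 4)

/-! ### Fibre algebra: the basis spinors `u₀ = (0, 1)` of `I` and `u₁ = (1, 0)` of `K⁻¹` in `S⁺` -/

/-- **The unit spinor `u₀` of the trivial summand `I ⊂ S⁺ = K⁻¹ ⊕ I`** in the fibre model: the
basis vector `Sum.inl 1` (the constants `Λ⁰`, Morgan 1996, Cor. 3.4.5). [cite: Taubes1994, §1 (p. 810)] -/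
def plusUnit : Spinor → ℂ := Pi.single (Sum.inl 1) 1

/-- **The unit spinor `u₁` of the summand `K⁻¹ ⊂ S⁺`** in the fibre model: the basis vector
`Sum.inl 0` (the line `Λ²_ℂ = Λ^{0,2}` on which `ρ(U)` acts by `det U`). [cite: Taubes1994, §1 (p. 810)] -/
def detUnit : Spinor → ℂ := Pi.single (Sum.inl 0) 1

/-- The `u₀`-component of `u₀` is `1`. [folklore] -/
@[simp] theorem plusUnit_inl_one : plusUnit (Sum.inl 1) = 1 := by simp [plusUnit]

/-- The `u₁`-component of `u₀` is `0`. [folklore] -/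
@[simp] theorem plusUnit_inl_zero : plusUnit (Sum.inl 0) = 0 := by simp [plusUnit]

/-- The `S⁻`-components of `u₀` vanish. [folklore] -/
@[simp] theorem plusUnit_inr (b : Fin 2) : plusUnit (Sum.inr b) = 0 := by simp [plusUnit]

/-- The `u₁`-component of `u₁` is `1`. [folklore] -/
@[simp] theorem detUnit_inl_zero : detUnit (Sum.inl 0) = 1 := by simp [detUnit]

/-- The `u₀`-component of `u₁` is `0`. [folklore] -/
@[simp] theorem detUnit_inl_one : detUnit (Sum.inl 1) = 0 := by simp [detUnit]

/-- The `S⁻`-components of `u₁` vanish. [folklore] -/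
@[simp] theorem detUnit_inr (b : Fin 2) : detUnit (Sum.inr b) = 0 := by simp [detUnit]

/-- The `u₀`-column of `ρ(U)` is `u₀`: `ρ(U)_{a, u₀} = δ_{a, u₀}`. [cite: MorganSWBook1996, Cor. 3.4.5] -/
theorem blockLift_apply_inl_one (U : Matrix (Fin 2) (Fin 2) ℂ) (a : Spinor) :
    blockLift U a (Sum.inl 1) = plusUnit a := by
  rcases a with a | a
  · fin_cases a <;> simp [blockLift, Matrix.fromBlocks_apply₁₁, Matrix.diagonal, plusUnit]
  · simp [blockLift, Matrix.fromBlocks_apply₂₁, plusUnit]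

/-- The `u₀`-row of `ρ(U)` is `u₀`: `ρ(U)_{u₀, b} = δ_{u₀, b}`. [cite: MorganSWBook1996, Cor. 3.4.5] -/
theorem blockLift_inl_one_apply (U : Matrix (Fin 2) (Fin 2) ℂ) (b : Spinor) :
    blockLift U (Sum.inl 1) b = plusUnit b := by
  rcases b with b | b
  · fin_cases b <;> simp [blockLift, Matrix.fromBlocks_apply₁₁, Matrix.diagonal, plusUnit]
  · simp [blockLift, Matrix.fromBlocks_apply₁₂, plusUnit]

/-- **`ρ(U)` fixes `u₀`** (`S⁺ ≈ I ⊕ K⁻¹` with `I` trivial). [cite: Taubes1994, §1 (p. 810)] -/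
theorem blockLift_mulVec_plusUnit (U : Matrix (Fin 2) (Fin 2) ℂ) : blockLift U *ᵥ plusUnit = plusUnit := by
  ext a
  simp only [Matrix.mulVec, dotProduct, Fintype.sum_sum_type, Fin.sum_univ_two, plusUnit_inl_zero,
    mul_zero, plusUnit_inl_one, mul_one, zero_add, plusUnit_inr, add_zero]
  exact blockLift_apply_inl_one U a

/-- The `u₀`-component of `ρ(U) w` is that of `w`. [cite: MorganSWBook1996, Cor. 3.4.5] -/
theorem blockLift_mulVec_apply_inl_one (U : Matrix (Fin 2) (Fin 2) ℂ) (w : Spinor → ℂ) :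
    (blockLift U *ᵥ w) (Sum.inl 1) = w (Sum.inl 1) := by
  simp only [Matrix.mulVec, dotProduct, blockLift_inl_one_apply]
  simp [Fintype.sum_sum_type, Fin.sum_univ_two]

/-- **`ρ(U)` acts on the `u₁`-component by `det U`** (`K⁻¹ = det P̃`). [cite: MorganSWBook1996, Cor. 3.4.5] -/
theorem blockLift_mulVec_apply_inl_zero (U : Matrix (Fin 2) (Fin 2) ℂ) (w : Spinor → ℂ) :
    (blockLift U *ᵥ w) (Sum.inl 0) = U.det * w (Sum.inl 0) := by
  simp [Matrix.mulVec, dotProduct, Fintype.sum_sum_type, blockLift, Matrix.fromBlocks_apply₁₁,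
    Matrix.fromBlocks_apply₁₂, Matrix.diagonal]

/-- `u₀` and `u₁` lie in `S⁺`. [cite: MorganSWBook1996, Cor. 2.4.5] -/
@[simp] theorem volumeElement_mulVec_plusUnit : volumeElement *ᵥ plusUnit = plusUnit :=
  (SpincStructure.volumeElement_mulVec_eq_self_iff _).2 plusUnit_inr

/-- `u₁ ∈ S⁺`. [cite: MorganSWBook1996, Cor. 2.4.5] -/
@[simp] theorem volumeElement_mulVec_detUnit : volumeElement *ᵥ detUnit = detUnit :=
  (SpincStructure.volumeElement_mulVec_eq_self_iff _).2 detUnit_inr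

/-- `|u₀|² = 1`. [cite: Taubes1994, §1 (p. 810)] -/
@[simp] theorem spinorHermNormSq_plusUnit : spinorHermNormSq plusUnit = 1 := by
  simp [spinorHermNormSq, Fintype.sum_sum_type, Fin.sum_univ_two]

/-- A positive spinor is `ψ₁ u₀ + ψ₀ u₁`. [cite: Taubes1994, §1 (p. 811)] -/
theorem eq_smul_plusUnit_add_smul_detUnit {s : Spinor → ℂ} (h : volumeElement *ᵥ s = s) :
    s = s (Sum.inl 1) • plusUnit + s (Sum.inl 0) • detUnit := by
  ext a
  rcases a with a | a
  · fin_cases a <;> simp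
  · simp [SpincStructure.apply_inr_eq_zero_of_volumeElement_mulVec_eq h a]

/-- **`Σ_k b_k γ_k u₁ = (0, 0; -b₀ + i b₁, -b₂ + i b₃)`**: Clifford contraction of a complex covector
`b` with `u₁` (`γ₀u₁ = (-1, 0)`, `γ₁u₁ = (i, 0)`, `γ₂u₁ = (0, -1)`, `γ₃u₁ = (0, i)` in `S⁻`).
[cite: Taubes1994, §1 (3)] -/
theorem sum_smul_cliffordBasis_mulVec_detUnit_apply (b : Fin 4 → ℂ) :
    (∀ a : Fin 2, (∑ k : Fin 4, b k • (cliffordBasis k *ᵥ detUnit)) (Sum.inl a) = 0) ∧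
    (∑ k : Fin 4, b k • (cliffordBasis k *ᵥ detUnit)) (Sum.inr 0) = -b 0 + I * b 1 ∧
    (∑ k : Fin 4, b k • (cliffordBasis k *ᵥ detUnit)) (Sum.inr 1) = -b 2 + I * b 3 := by
  simp only [Fin.sum_univ_four, Pi.add_apply, Pi.smul_apply, smul_eq_mul, cliffordBasis, cliffordGamma,
    quatMatrix_quatBasis_zero, quatMatrix_quatBasis_one, quatMatrix_quatBasis_two, quatMatrix_quatBasis_three,
    Matrix.mulVec, dotProduct, Fintype.sum_sum_type, Fin.sum_univ_two, detUnit_inl_zero, detUnit_inl_one,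
    detUnit_inr, mul_one, mul_zero, add_zero]
  refine ⟨fun a ↦ ?_, ?_, ?_⟩
  · simp [Matrix.fromBlocks_apply₁₁]
  · simp [Matrix.fromBlocks_apply₂₁, Matrix.conjTranspose_apply]; ring
  · simp [Matrix.fromBlocks_apply₂₁, Matrix.conjTranspose_apply]; ring

/-- **Taubes 1994, (3)**: Clifford multiplication by a complex covector `b = (b_k)` annihilates the
`K⁻¹` summand iff `b₀ = i b₁` and `b₂ = i b₃` ("`v` should be a section of `T*⁰'¹`"; Taubes's
indices `1…4`). [cite: Taubes1994, §1 (3)] -/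
theorem sum_smul_cliffordBasis_mulVec_detUnit_eq_zero_iff (b : Fin 4 → ℂ) :
    ∑ k : Fin 4, b k • (cliffordBasis k *ᵥ detUnit) = 0 ↔ b 0 = I * b 1 ∧ b 2 = I * b 3 := by
  obtain ⟨hl, h0, h1⟩ := sum_smul_cliffordBasis_mulVec_detUnit_apply b
  constructor
  · intro h
    rw [h] at h0 h1
    simp only [Pi.zero_apply] at h0 h1
    constructor
    · linear_combination h0
    · linear_combination h1
  · rintro ⟨e0, e1⟩
    have hr : ∀ a : Fin 2, (∑ k : Fin 4, b k • (cliffordBasis k *ᵥ detUnit)) (Sum.inr a) = 0 :=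
      Fin.forall_fin_two.2 ⟨by rw [h0, e0]; ring, by rw [h1, e1]; ring⟩
    ext a
    rcases a with a | a
    · exact hl a
    · exact hr a

/-! ### Entries of block matrices commuting with the volume element -/

/-- A matrix commuting with `ω_ℂ` has vanishing `S⁺ → S⁻` entries. [cite: MorganSWBook1996, Cor. 2.4.5] -/
theorem apply_inr_inl_eq_zero_of_mul_volumeElement {M : Matrix Spinor Spinor ℂ}
    (h : M * volumeElement = volumeElement * M) (b a : Fin 2) : M (Sum.inr b) (Sum.inl a) = 0 := by
  have h1 := congr_fun (congr_fun h (Sum.inr b)) (Sum.inl a)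
  simp [volumeElement, Matrix.mul_apply, Fintype.sum_sum_type, Matrix.fromBlocks_apply₁₁,
    Matrix.fromBlocks_apply₂₁, Matrix.fromBlocks_apply₂₂, Matrix.one_apply] at h1
  fin_cases a <;> fin_cases b <;> simp at h1 ⊢ <;> linear_combination h1 / 2

/-- A skew-hermitian matrix has purely imaginary diagonal entries. [folklore] -/
theorem re_apply_self_eq_zero_of_conjTranspose {M : Matrix Spinor Spinor ℂ} (h : Mᴴ = -M) (a : Spinor) :
    (M a a).re = 0 := by
  have h1 := congr_fun (congr_fun h a) a
  rw [Matrix.conjTranspose_apply, Matrix.neg_apply, Complex.star_def] at h1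
  have := congr_arg Complex.re h1
  simp only [Complex.conj_re, Complex.neg_re] at this
  linarith

/-- For `G = ρ(U)`: `(Gᴴ M G)_{u₀u₀} = M_{u₀u₀}` (the `u₀`-column of `G` is `u₀`). [cite: MorganSWBook1996, Cor. 3.4.5] -/
theorem conjTranspose_blockLift_mul_mul_blockLift_apply (U : Matrix (Fin 2) (Fin 2) ℂ) (M : Matrix Spinor Spinor ℂ) :
    ((blockLift U)ᴴ * M * blockLift U) (Sum.inl 1) (Sum.inl 1) = M (Sum.inl 1) (Sum.inl 1) := by
  have hcol : ∀ a : Spinor, blockLift U a (Sum.inl 1) = plusUnit a := blockLift_apply_inl_one U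
  simp only [Matrix.mul_apply, Matrix.conjTranspose_apply, hcol]
  simp [Fintype.sum_sum_type, Fin.sum_univ_two]

/-- **The coefficients of `A₀ᵢ` in the Levi-Civita forms**: `c_{kl} = -Im (γ_kγ_l)_{u₀u₀}` for
`k < l` (else `0`), so that `-2 Im dρ(Ω)_{u₀u₀} = Σ_{k,l} c_{kl} Ω_{lk}` for a real matrix `Ω`.
[cite: MorganSWBook1996, Lemma 3.2.4] -/
def canonicalCoeff (k l : Fin 4) : ℝ :=
  if k < l then -((cliffordBasis k * cliffordBasis l) (Sum.inl 1) (Sum.inl 1)).im else 0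

/-- **`-2 Im dρ(Ω)_{u₀u₀} = Σ_{k,l} c_{kl} Ω_{lk}`** for a real matrix `Ω` (`dρ(Ω) = ½ Σ_{k<l} Ω_{lk} γ_kγ_l`).
[cite: MorganSWBook1996, Lemma 3.2.4] -/
theorem neg_two_mul_im_spinRepDeriv_inl_one (Ω : Matrix (Fin 4) (Fin 4) ℝ) :
    -2 * (spinRepDeriv Ω (Sum.inl 1) (Sum.inl 1)).im = ∑ k, ∑ l, canonicalCoeff k l * Ω l k := by
  have h : spinRepDeriv Ω (Sum.inl 1) (Sum.inl 1) = (2 : ℂ)⁻¹ *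
      ∑ k, ∑ l, (if k < l then ((Ω l k : ℝ) : ℂ) * (cliffordBasis k * cliffordBasis l) (Sum.inl 1) (Sum.inl 1) else 0) := by
    simp only [spinRepDeriv, Matrix.smul_apply, Matrix.sum_apply, smul_eq_mul]
    congr 1
  have h2 : ∀ z : ℂ, -2 * ((2 : ℂ)⁻¹ * z).im = -z.im := by
    intro z
    rw [show (2 : ℂ)⁻¹ = ((2⁻¹ : ℝ) : ℂ) by norm_num, Complex.im_ofReal_mul]
    ring
  rw [h, h2, Complex.im_sum, ← Finset.sum_neg_distrib]
  refine Finset.sum_congr rfl fun k _ ↦ ?_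
  rw [Complex.im_sum, ← Finset.sum_neg_distrib]
  refine Finset.sum_congr rfl fun l _ ↦ ?_
  unfold canonicalCoeff
  split_ifs
  · rw [Complex.im_ofReal_mul]; ring
  · simp

/-! ### The canonical spinor `u₀` of the `Spin^c` structure of adapted frames -/

section Bundle

variable {X : Type*} [TopologicalSpace X] [ChartedSpace 𝔼⁴ X] [IsManifold (𝓡 4) ∞ X]
  {g : PseudoRiemannianMetric (𝓡 4) ∞ 𝔼⁴ (TangentSpace (𝓡 4) : X → Type _)}
  {o : SmoothOrientation (𝓡 4) X} {J : Π x : X, TangentSpace (𝓡 4) x →ₗ[ℝ] TangentSpace (𝓡 4) x}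
  {ι : Type*}

/-- **The functional `v ↦ g_x(L v, w)`** of a continuous linear map `L` of `T_x X` and a vector `w`,
as a continuous linear functional (the building block `v ↦ g(∇^{LC}_v e_k, e_l)` of the Levi-Civita
connection forms `ω̃_{l,k}`). [cite: MorganSWBook1996, §3.2] -/
def metricPairing (g : PseudoRiemannianMetric (𝓡 4) ∞ 𝔼⁴ (TangentSpace (𝓡 4) : X → Type _)) (x : X)
    (L : TangentSpace (𝓡 4) x →L[ℝ] TangentSpace (𝓡 4) x) (w : TangentSpace (𝓡 4) x) :
    TangentSpace (𝓡 4) x →L[ℝ] ℝ where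
  toFun v := g.val x (L v) w
  map_add' v v' := by simp
  map_smul' c v := by simp
  cont := (continuous_eval_const w).comp ((g.val x).continuous.comp L.continuous)

/-- Unfolding `metricPairing`. [cite: MorganSWBook1996, §3.2] -/
@[simp] theorem metricPairing_apply (g : PseudoRiemannianMetric (𝓡 4) ∞ 𝔼⁴ (TangentSpace (𝓡 4) : X → Type _))
    (x : X) (L : TangentSpace (𝓡 4) x →L[ℝ] TangentSpace (𝓡 4) x) (w v : TangentSpace (𝓡 4) x) :
    metricPairing g x L w v = g.val x (L v) w := rfl

namespace AdaptedFrames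

variable (𝔞 : AdaptedFrames g o J ι)

/-- **Taubes's canonical spinor `u₀`** of the `Spin^c` structure of an almost complex structure: the
unit section of the trivial summand `I` of `S⁺ ≈ I ⊕ K⁻¹`, with local representative `u₀ = (0, 1)`
in every chart of adapted frames (Taubes 1994, §1; Taubes 1995, (5.1); Morgan 1996, Cor. 3.4.5:
`S⁺ = Λ⁰ ⊕ Λ^{0,2}`).  It is a spinor field because every transition function `ρ(U_ij)` fixes `u₀`.
[cite: Taubes1994, §1 (p. 810)] -/
def canonicalSpinor : SpinorField 𝔞.toSpincStructure where
  toFun _ _ := plusUnit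
  mulVec_toFun i j x _ := by
    rw [toSpincStructure_transition, blockLift_mulVec_plusUnit]

/-- The local representatives of `u₀` (definitional). [cite: Taubes1994, §1 (p. 810)] -/
@[simp] theorem canonicalSpinor_toFun (i : ι) (x : X) : 𝔞.canonicalSpinor.toFun i x = plusUnit := rfl

/-- `u₀` is a positive spinor field (a section of `S⁺`). [cite: Taubes1994, §1 (p. 810)] -/
theorem isPlus_canonicalSpinor : 𝔞.canonicalSpinor.IsPlus :=
  fun _ _ _ ↦ volumeElement_mulVec_plusUnit

/-- `u₀` is smooth. [cite: Taubes1994, §1 (p. 810)] -/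
theorem isSmooth_canonicalSpinor : 𝔞.canonicalSpinor.IsSmooth :=
  fun _ _ ↦ contMDiffOn_const

/-- **`u₀` has unit length**: `|u₀|²(x) = 1` at every point ("This section `u₀` has constant length and
should be normalized to have length equal to `1`"). [cite: Taubes1994, §1 (p. 810)] -/
@[simp] theorem hermNormSq_canonicalSpinor (x : X) : 𝔞.canonicalSpinor.hermNormSq x = 1 := by
  rw [SpinorField.hermNormSq, canonicalSpinor_toFun, spinorHermNormSq_plusUnit]

/-- `u₀` vanishes nowhere. [cite: Taubes1995, §5 Step 1 (p. 233)] -/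
theorem canonicalSpinor_toFun_ne_zero (i : ι) (x : X) : 𝔞.canonicalSpinor.toFun i x ≠ 0 := by
  intro h
  have := congr_fun h (Sum.inl 1)
  simp at this

/-- The local representatives of `u₀` are differentiable (they are constant). [folklore] -/
theorem spinorMDiffAt_canonicalSpinor (i : ι) (x : X) : SpinorMDiffAt (𝔞.canonicalSpinor.toFun i) x :=
  fun _ ↦ mdifferentiableAt_const

/-- `du₀ = 0` chartwise. [folklore] -/
@[simp] theorem spinorDeriv_canonicalSpinor (i : ι) (x : X) (v : TangentSpace (𝓡 4) x) :
    spinorDeriv (𝔞.canonicalSpinor.toFun i) x v = 0 := by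
  funext a
  simp only [spinorDeriv, canonicalSpinor_toFun]
  exact complexDeriv_const _ x v

/-! #### The splitting `S⁺ ≈ I ⊕ K⁻¹` on sections -/

/-- **The `I`-component of a spinor field is a function**: `ψ_i(x)_{u₀} = ψ_j(x)_{u₀}` on `U_i ∩ U_j`.
[cite: Taubes1994, §1 (p. 811)] -/
theorem toFun_inl_one_eq (ψ : SpinorField 𝔞.toSpincStructure) {i j : ι} {x : X}
    (hx : x ∈ 𝔞.baseSet i ∩ 𝔞.baseSet j) : ψ.toFun i x (Sum.inl 1) = ψ.toFun j x (Sum.inl 1) := by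
  rw [← ψ.mulVec_toFun i j x hx, toSpincStructure_transition, blockLift_mulVec_apply_inl_one]

/-- **The `K⁻¹`-component of a spinor field is a section of `det P̃ = K⁻¹`**:
`ψ_i(x)_{u₁} = λ_ij(x) ψ_j(x)_{u₁}` with `λ_ij = det U_ij` the determinant cocycle. [cite: Taubes1994, §1 (p. 811)] -/
theorem toFun_inl_zero_eq (ψ : SpinorField 𝔞.toSpincStructure) {i j : ι} {x : X}
    (hx : x ∈ 𝔞.baseSet i ∩ 𝔞.baseSet j) :
    ψ.toFun i x (Sum.inl 0) = 𝔞.toSpincStructure.detLineBundle.toFun i j x * ψ.toFun j x (Sum.inl 0) := by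
  rw [← ψ.mulVec_toFun i j x hx, toSpincStructure_transition, blockLift_mulVec_apply_inl_zero,
    detLineBundle_toSpincStructure_toFun]

/-- **A positive spinor field is `ψ = α u₀ + β u₁` chartwise**, `α = ψ_{u₀}` a function, `β = ψ_{u₁}`
a section of `K⁻¹` (Taubes's `ψ ≡ α · u₀ + β`; Morgan 1996, §7.1, `ψ = (β, α)`).
[cite: Taubes1994, §1 (p. 811)] -/
theorem _root_.Literature.Geometry.GaugeTheory.SpinorField.IsPlus.toFun_eq_of_adaptedFrames
    {ψ : SpinorField 𝔞.toSpincStructure} (hψ : ψ.IsPlus) {i : ι} {x : X} (hx : x ∈ 𝔞.baseSet i) :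
    ψ.toFun i x = ψ.toFun i x (Sum.inl 1) • plusUnit + ψ.toFun i x (Sum.inl 0) • detUnit :=
  eq_smul_plusUnit_add_smul_detUnit (hψ i x hx)

/-! #### The covariant derivative of `u₀` and Taubes's connection forms `A₀ᵢ` -/

section Connection

variable [g.HasLeviCivita]

/-- **`∇̃^A_v u₀ = ½ iA_i(v) u₀ + dρ(ω̃^{(i)}(v)) u₀`** for every unitary connection `A` on `det P̃`
(formula (3.2) on the constant representative `u₀`). [cite: MorganSWBook1996, §3.2 (3.2)] -/
theorem covDeriv_canonicalSpinor (A : 𝔞.toSpincStructure.detLineBundle.Connection) (i : ι) (x : X)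
    (v : TangentSpace (𝓡 4) x) :
    SpincStructure.covDeriv A 𝔞.canonicalSpinor i x v =
      ((2 : ℂ)⁻¹ * (I * ((A.form i x v : ℝ) : ℂ))) • plusUnit +
        𝔞.toSpincStructure.spinConnectionEnd i x v *ᵥ plusUnit := by
  rw [SpincStructure.covDeriv, spinorDeriv_canonicalSpinor, zero_add, canonicalSpinor_toFun]

/-- **The `I`-component of `∇̃^A_v u₀`**: `½ iA_i(v) + dρ(ω̃^{(i)}(v))_{u₀u₀}`. [cite: Taubes1994, §1 (p. 810)] -/
theorem covDeriv_canonicalSpinor_inl_one (A : 𝔞.toSpincStructure.detLineBundle.Connection) (i : ι) (x : X)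
    (v : TangentSpace (𝓡 4) x) :
    SpincStructure.covDeriv A 𝔞.canonicalSpinor i x v (Sum.inl 1) =
      (2 : ℂ)⁻¹ * (I * ((A.form i x v : ℝ) : ℂ)) +
        𝔞.toSpincStructure.spinConnectionEnd i x v (Sum.inl 1) (Sum.inl 1) := by
  rw [covDeriv_canonicalSpinor]
  simp [plusUnit]

variable {𝔞} in
/-- **Taubes's `b`**: the `K⁻¹`-component `b_i(v) = dρ(ω̃^{(i)}(v))_{u₁u₀}` of `∇̃_v u₀` in the chart
`i` — independent of the connection `A` ("`∇_{A₀} u₀ = b` where `b` is a section of `K⁻¹ ⊗ T*_ℂ X`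
… essentially the torsion of the almost complex structure"). [cite: Taubes1994, §1 (1)] -/
def canonicalTorsion (𝔞 : AdaptedFrames g o J ι) (i : ι) (x : X) (v : TangentSpace (𝓡 4) x) : ℂ :=
  𝔞.toSpincStructure.spinConnectionEnd i x v (Sum.inl 0) (Sum.inl 1)

/-- The `K⁻¹`-component of `∇̃^A_v u₀` is `b_i(v)`, for every `A`. [cite: Taubes1994, §1 (1)] -/
theorem covDeriv_canonicalSpinor_inl_zero (A : 𝔞.toSpincStructure.detLineBundle.Connection) (i : ι) (x : X)
    (v : TangentSpace (𝓡 4) x) :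
    SpincStructure.covDeriv A 𝔞.canonicalSpinor i x v (Sum.inl 0) = 𝔞.canonicalTorsion i x v := by
  rw [covDeriv_canonicalSpinor, canonicalTorsion]
  simp [plusUnit]

/-- The `S⁻`-components of `∇̃^A_v u₀` vanish (`dρ` preserves `S⁺`). [cite: MorganSWBook1996, §3.2] -/
theorem covDeriv_canonicalSpinor_inr (A : 𝔞.toSpincStructure.detLineBundle.Connection) (i : ι) (x : X)
    (v : TangentSpace (𝓡 4) x) (b : Fin 2) :
    SpincStructure.covDeriv A 𝔞.canonicalSpinor i x v (Sum.inr b) = 0 := by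
  have h0 : 𝔞.toSpincStructure.spinConnectionEnd i x v (Sum.inr b) (Sum.inl 1) = 0 :=
    apply_inr_inl_eq_zero_of_mul_volumeElement (𝔞.toSpincStructure.spinConnectionEnd_mul_volumeElement i x v) b 1
  rw [covDeriv_canonicalSpinor]
  simp [plusUnit, h0]

/-- **`∇̃^A_v u₀ = (½ iA_i(v) + dρ(ω̃^{(i)}(v))_{u₀u₀}) u₀ + b_i(v) u₁`.** [cite: Taubes1994, §1 (1)] -/
theorem covDeriv_canonicalSpinor_eq (A : 𝔞.toSpincStructure.detLineBundle.Connection) (i : ι) (x : X)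
    (v : TangentSpace (𝓡 4) x) :
    SpincStructure.covDeriv A 𝔞.canonicalSpinor i x v =
      ((2 : ℂ)⁻¹ * (I * ((A.form i x v : ℝ) : ℂ)) +
          𝔞.toSpincStructure.spinConnectionEnd i x v (Sum.inl 1) (Sum.inl 1)) • plusUnit +
        𝔞.canonicalTorsion i x v • detUnit := by
  ext a
  rcases a with a | a
  · fin_cases a
    · simpa using 𝔞.covDeriv_canonicalSpinor_inl_zero A i x v
    · simpa using 𝔞.covDeriv_canonicalSpinor_inl_one A i x v
  · simpa using 𝔞.covDeriv_canonicalSpinor_inr A i x v a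

/-- The diagonal entry `dρ(ω̃^{(i)}(v))_{u₀u₀}` is purely imaginary (`dρ` is skew-hermitian).
[cite: MorganSWBook1996, §3.2] -/
theorem re_spinConnectionEnd_inl_one (i : ι) (x : X) (v : TangentSpace (𝓡 4) x) :
    (𝔞.toSpincStructure.spinConnectionEnd i x v (Sum.inl 1) (Sum.inl 1)).re = 0 :=
  re_apply_self_eq_zero_of_conjTranspose (𝔞.toSpincStructure.conjTranspose_spinConnectionEnd i x v) _

variable {𝔞} in
/-- **The local connection forms `A₀ᵢ` of Taubes's connection `A₀`** on `K⁻¹ = det P̃`: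
`A₀ᵢ(v) = -2 Im dρ(ω̃^{(i)}(v))_{u₀u₀}`, the unique real number with
`½ iA₀ᵢ(v) + dρ(ω̃^{(i)}(v))_{u₀u₀} = 0`, i.e. making the `I`-component of `∇̃_v u₀` vanish ("`∇_{A₀}`
… equal to the product covariant derivative `d` on the summand `I`"). [cite: Taubes1994, §1 (p. 810)] -/
def canonicalFormFun (𝔞 : AdaptedFrames g o J ι) (i : ι) (x : X) (v : TangentSpace (𝓡 4) x) : ℝ :=
  -2 * (𝔞.toSpincStructure.spinConnectionEnd i x v (Sum.inl 1) (Sum.inl 1)).im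

/-- **`iA₀ᵢ(v) = -2 dρ(ω̃^{(i)}(v))_{u₀u₀}`** (as complex numbers; the entry is imaginary).
[cite: Taubes1994, §1 (p. 810)] -/
theorem I_mul_canonicalFormFun (i : ι) (x : X) (v : TangentSpace (𝓡 4) x) :
    I * ((𝔞.canonicalFormFun i x v : ℝ) : ℂ) =
      -2 * 𝔞.toSpincStructure.spinConnectionEnd i x v (Sum.inl 1) (Sum.inl 1) := by
  have hre := 𝔞.re_spinConnectionEnd_inl_one i x v
  apply Complex.ext <;> simp [canonicalFormFun, hre]

/-- **`½ iA₀ᵢ(v) + dρ(ω̃^{(i)}(v))_{u₀u₀} = 0`.** [cite: Taubes1994, §1 (p. 810)] -/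
theorem half_I_mul_canonicalFormFun_add (i : ι) (x : X) (v : TangentSpace (𝓡 4) x) :
    (2 : ℂ)⁻¹ * (I * ((𝔞.canonicalFormFun i x v : ℝ) : ℂ)) +
      𝔞.toSpincStructure.spinConnectionEnd i x v (Sum.inl 1) (Sum.inl 1) = 0 := by
  rw [I_mul_canonicalFormFun]; ring

/-- **Characterisation (uniqueness of `A₀`, chart by chart)**: for a unitary connection `A` on
`det P̃`, the `I`-component of `∇̃^A_v u₀` in the chart `i` vanishes iff `A_i(v) = A₀ᵢ(v)` ("There is a
unique connection `A₀` … whose induced covariant derivative … [is] equal to the product covariant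
derivative `d` on the summand `I`"). [cite: Taubes1994, §1 (p. 810)] -/
theorem covDeriv_canonicalSpinor_inl_one_eq_zero_iff (A : 𝔞.toSpincStructure.detLineBundle.Connection) (i : ι)
    (x : X) (v : TangentSpace (𝓡 4) x) :
    SpincStructure.covDeriv A 𝔞.canonicalSpinor i x v (Sum.inl 1) = 0 ↔ A.form i x v = 𝔞.canonicalFormFun i x v := by
  rw [covDeriv_canonicalSpinor_inl_one]
  have h0 := 𝔞.half_I_mul_canonicalFormFun_add i x v
  constructor
  · intro h
    have h2 : I * ((A.form i x v : ℝ) : ℂ) = I * ((𝔞.canonicalFormFun i x v : ℝ) : ℂ) := by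
      linear_combination (2 : ℂ) * h - (2 : ℂ) * h0
    have h3 := mul_left_cancel₀ I_ne_zero h2
    exact_mod_cast h3
  · intro h
    rw [h, h0]

/-- **For a connection with `A_i(v) = A₀ᵢ(v)`: `∇̃_v u₀ = b_i(v) u₁`** — Taubes's (1), `∇_{A₀} u₀ = b`.
[cite: Taubes1994, §1 (1)] -/
theorem covDeriv_canonicalSpinor_of_eq (A : 𝔞.toSpincStructure.detLineBundle.Connection) {i : ι} {x : X}
    {v : TangentSpace (𝓡 4) x} (hA : A.form i x v = 𝔞.canonicalFormFun i x v) :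
    SpincStructure.covDeriv A 𝔞.canonicalSpinor i x v = 𝔞.canonicalTorsion i x v • detUnit := by
  rw [covDeriv_canonicalSpinor_eq, hA, half_I_mul_canonicalFormFun_add, zero_smul, zero_add]

/-- **The Dirac operator on `u₀` for a connection with `A_i = A₀ᵢ` at `x`**:
`∂_A u₀ = Σ_k b_i(e_k) γ_k u₁` ("`e^ν b_ν`", Clifford contraction of `b` with `u₁`).
[cite: Taubes1994, §1 (p. 810)] -/
theorem dirac_canonicalSpinor_of_forall (A : 𝔞.toSpincStructure.detLineBundle.Connection) {i : ι} {x : X}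
    (hA : ∀ v : TangentSpace (𝓡 4) x, A.form i x v = 𝔞.canonicalFormFun i x v) :
    SpincStructure.dirac A 𝔞.canonicalSpinor i x =
      ∑ k : Fin 4, 𝔞.canonicalTorsion i x (𝔞.frame i k x) • (cliffordBasis k *ᵥ detUnit) := by
  simp only [SpincStructure.dirac, 𝔞.covDeriv_canonicalSpinor_of_eq A (hA _), Matrix.mulVec_smul]
  rfl

/-- **`u₀` solves the Dirac equation iff `b` is of type `(0,1)`**: for a connection with `A_i = A₀ᵢ`
at `x`, `∂_A u₀(x) = 0 ↔ b₀ = i b₁ ∧ b₂ = i b₃` where `b_k = b_i(e_k)` (Taubes 1994: "The spinor `u₀`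
solves the Dirac equation when … `e^ν b_ν = 0`", and (3): "`v` should be a section of `T*⁰'¹`").
[cite: Taubes1994, §1 (3)] -/
theorem dirac_canonicalSpinor_eq_zero_iff (A : 𝔞.toSpincStructure.detLineBundle.Connection) {i : ι} {x : X}
    (hA : ∀ v : TangentSpace (𝓡 4) x, A.form i x v = 𝔞.canonicalFormFun i x v) :
    SpincStructure.dirac A 𝔞.canonicalSpinor i x = 0 ↔
      𝔞.canonicalTorsion i x (𝔞.frame i 0 x) = I * 𝔞.canonicalTorsion i x (𝔞.frame i 1 x) ∧
        𝔞.canonicalTorsion i x (𝔞.frame i 2 x) = I * 𝔞.canonicalTorsion i x (𝔞.frame i 3 x) := by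
  rw [𝔞.dirac_canonicalSpinor_of_forall A hA]
  exact sum_smul_cliffordBasis_mulVec_detUnit_eq_zero_iff fun k ↦ 𝔞.canonicalTorsion i x (𝔞.frame i k x)

/-! #### `A₀ᵢ` as a real 1-form and its gauge law -/

variable {𝔞} in
/-- **Taubes's connection forms `A₀ = (A₀ᵢ)` as a real 1-form on each chart**, written as the finite
sum `A₀ᵢ(v) = Σ_{k,l} c_{kl} g(∇^{LC}_v e^{(i)}_k, e^{(i)}_l)` of continuous linear functionals of `v`
(`neg_two_mul_im_spinRepDeriv_inl_one` with `Ω = ω̃^{(i)}(v)`). [cite: Taubes1994, §1 (p. 810)] -/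
def canonicalForm (𝔞 : AdaptedFrames g o J ι) (i : ι) : RealOneForm X := fun x ↦
  ∑ k : Fin 4, ∑ l : Fin 4, canonicalCoeff k l •
    metricPairing g x (g.leviCivita (𝔞.frame i k) x) (𝔞.frame i l x)

/-- **`A₀ᵢ(v) = -2 Im dρ(ω̃^{(i)}(v))_{u₀u₀}`** (`canonicalForm` is `canonicalFormFun`).
[cite: Taubes1994, §1 (p. 810)] -/
@[simp] theorem canonicalForm_apply (i : ι) (x : X) (v : TangentSpace (𝓡 4) x) :
    𝔞.canonicalForm i x v = 𝔞.canonicalFormFun i x v := by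
  rw [canonicalFormFun, SpincStructure.spinConnectionEnd, neg_two_mul_im_spinRepDeriv_inl_one]
  simp only [canonicalForm, FunLike.coe_sum, Finset.sum_apply, FunLike.coe_smul, Pi.smul_apply,
    metricPairing_apply, smul_eq_mul, SpincStructure.lcForm_apply]
  rfl

omit [g.HasLeviCivita] in
/-- The `u₀u₀`-entry of `G_ij(y)` is the constant `1`. [cite: MorganSWBook1996, Cor. 3.4.5] -/
theorem transition_inl_one_inl_one (i j : ι) (y : X) :
    𝔞.toSpincStructure.transition i j y (Sum.inl 1) (Sum.inl 1) = 1 := by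
  rw [toSpincStructure_transition, blockLift_apply_inl_one, plusUnit_inl_one]

omit [g.HasLeviCivita] in
/-- `(G_ijᴴ dG_ij(v))_{u₀u₀} = 0`: the `u₀`-column of `G_ij` is constant. [cite: MorganSWBook1996, Cor. 3.4.5] -/
theorem conjTranspose_mul_matDeriv_transition_inl_one (i j : ι) (x : X) (v : TangentSpace (𝓡 4) x) :
    ((𝔞.toSpincStructure.transition i j x)ᴴ * matDeriv (𝔞.toSpincStructure.transition i j) x v)
      (Sum.inl 1) (Sum.inl 1) = 0 := by
  have hcol : ∀ y (a : Spinor), 𝔞.toSpincStructure.transition i j y a (Sum.inl 1) = plusUnit a := fun y a ↦ by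
    rw [toSpincStructure_transition, blockLift_apply_inl_one]
  simp only [Matrix.mul_apply, Matrix.conjTranspose_apply, matDeriv_apply, hcol, complexDeriv_const]
  simp

/-- **The gauge law of `A₀`**: on `U_i ∩ U_j`, `iA₀ⱼ(v) = iA₀ᵢ(v) + λ̄_ij dλ_ij(v)` with
`λ_ij = det U_ij` the determinant cocycle — the local forms `A₀ᵢ` ARE the local forms of a unitary
connection on `det P̃ = K⁻¹` (Kobayashi's (1.16)).  From the transformation law
`dρ(ω̃^{(j)}) = G_ijᴴ dρ(ω̃^{(i)}) G_ij + dρ(hᵀdh)` and `G_ijᴴ dG_ij = dρ(hᵀdh) + ½ λ̄_ij dλ_ij`, read in the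
`u₀u₀`-entry, where `G_ij = ρ(U_ij)` has the constant column `u₀`. [cite: Taubes1994, §1 (p. 810)] -/
theorem canonicalForm_gauge (i j : ι) {x : X} (hx : x ∈ 𝔞.baseSet i ∩ 𝔞.baseSet j) (v : TangentSpace (𝓡 4) x) :
    I * ((𝔞.canonicalForm j x v : ℝ) : ℂ) =
      I * ((𝔞.canonicalForm i x v : ℝ) : ℂ) +
        conj (𝔞.toSpincStructure.detLineBundle.toFun i j x) *
          complexDeriv (𝔞.toSpincStructure.detLineBundle.toFun i j) x v := by
  set 𝔰 := 𝔞.toSpincStructure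
  have hS := 𝔰.spinConnectionEnd_eq_of_mem_overlap i j hx v
  have hG := 𝔰.conjTranspose_mul_matDeriv_transition i j hx v
  -- `dρ(hᵀdh) = GᴴdG - ½ λ̄ dλ`
  have hMC : spinRepDeriv (𝔰.frameMaurerCartan i j x v) =
      (𝔰.transition i j x)ᴴ * matDeriv (𝔰.transition i j) x v -
        ((2 : ℂ)⁻¹ * (conj (𝔰.detLineBundle.toFun i j x) * complexDeriv (𝔰.detLineBundle.toFun i j) x v)) •
          (1 : Matrix Spinor Spinor ℂ) := by
    rw [hG]; abel
  -- read the `u₀u₀`-entry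
  have h11 := congr_fun (congr_fun hS (Sum.inl 1)) (Sum.inl 1)
  rw [hMC, Matrix.add_apply, Matrix.sub_apply, toSpincStructure_transition,
    conjTranspose_blockLift_mul_mul_blockLift_apply, ← toSpincStructure_transition,
    𝔞.conjTranspose_mul_matDeriv_transition_inl_one, Matrix.smul_apply, Matrix.one_apply_eq, smul_eq_mul,
    mul_one] at h11
  rw [canonicalForm_apply, canonicalForm_apply, I_mul_canonicalFormFun, I_mul_canonicalFormFun]
  change -2 * 𝔰.spinConnectionEnd j x v (Sum.inl 1) (Sum.inl 1) =
    -2 * 𝔰.spinConnectionEnd i x v (Sum.inl 1) (Sum.inl 1) + _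
  rw [h11]
  ring

end Connection

end AdaptedFrames

end Bundle

end Literature.Geometry.GaugeTheory

end
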